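import Mathlib
import Summits.HodgeConjecture.FermatCycles.HodgeFermatCorollaryM

/-!
# COROLLARY M with the clauses at 5 and 3 (`HodgeFermat/CorollaryMRows.lean`; HF-G29h) and its opening clause "3 ∣ m" with the corollary in final form (`CorollaryMThree.lean`; HF-G29i)

Tree copy of 2 SMALL MODULES of the sibling cell's standalone package `run/shared/lean/pub/pub-hodgefermat/lean/HodgeFermat/`,
concatenated IN DEPENDENCY ORDER in one tree file (one gate round-trip instead of 2; the hub's import-level build backlog was ≈ 50 min
per level when this file was assembled) — each module's body byte-identical to its source lines, its own `namespace … end` block kept: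
  1. `HodgeFermat/CorollaryMRows.lean` (110 lines, sha256 `e0f58769a3f1dfef…`), whole module, source lines 21–110 (all: `five_clause`, `not_Z3U`, `three_clause`, `corollaryM`) — pub-hodgefermat `CERT.md` l.951, GATE HF-G29h; cell record `check/CorollaryMRows_standalone.lean` sha256 `17010e13e1fbe52a…`;
  2. `HodgeFermat/CorollaryMThree.lean` (85 lines, sha256 `d82e8c11c822095b…`), whole module, source lines 25–85 (all: `three_dvd`, `corollaryM_final`) — pub-hodgefermat `CERT.md` l.954, GATE HF-G29i; cell record `check/CorollaryMThree_standalone.lean` sha256 `d8e5ed533b61b4b4…`;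
Filed by cell `pub-hfermat`, seat prover-1 gen-3, on the COORDINATOR KEEPER RULING of 2026-08-25 (gem sweep H1: take the
off-gate kernel theorem `thmFstar` through the gate) — here THEOREM F* of `tables/DPRIME-THEOREM.md` §9 IN FULL, i.e.
PROPOSITION D′(3N) and the descent (`HodgeFermat/PropDPrimeNFinal.lean`, GATE HF-G34), the last off-gate form of THEOREM F*
(its first two forms, `DecodingFinal.thmFstar` = F* at the prime levels and `ThmFstarNFinal.thmFstar` = F*(3N), landed on
2026-08-25 as `HodgeFermatThmFstar.lean` / `HodgeFermatThmFstarN.lean`, seats prover-1 gen-0 / gen-2); these modules are links of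
the import closure of `PropDPrimeNFinal.propDprime` (the sibling's KR-free chain: THEOREM L, COROLLARY M, THEOREM D6,
THEOREM U⁺, THEOREM KR6, THEOREM Z3U) on top of those landed chains.  Each source module is the sibling's module of record named in item 1–2 above; declarations are copied VERBATIM.
Deviations from the source modules, exhaustively: the `import` lines (tree modules `Summits.HodgeConjecture.FermatCycles.HodgeFermat*`
instead of `HodgeFermat.*`, hoisted to the top; the source `import` lines between the concatenated modules are dropped); this docstring
(replacing the modules' docstrings, all quoted below); none at file level beyond the concatenation itself; per module: (`CorollaryMThree`'s `import HodgeFermat.CorollaryMRows` points inside this file)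
  — module 1 (`CorollaryMRows.lean`): the source's `open HodgeFermat.KRFree.RowsFinal (five_pattern st_symm)` (l.28) becomes `open HodgeFermat.KRFree.RowsFinal (five_pattern)` + `open HodgeFermat.KRFree.Decoding (st_symm)` (the restated `RowsFinal.st_symm` was deleted in `HodgeFermatRowsFinal.lean` in favour of the landed `Decoding.st_symm`).
  — module 2 (`CorollaryMThree.lean`): none besides these.
Every other line — in particular every declaration's statement and proof — is byte-identical to its source.
HONEST FRAMING: explicit algebraic cycles for specific Hodge classes on Fermat/Delsarte varieties; residual open instances
listed; no claim on general Hodge.  (This file is arithmetic of CM types / finite combinatorics / analytic number theory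
of the sibling's KR-free programme; it claims nothing about cycles.)

(1) The docstring of `HodgeFermat/CorollaryMRows.lean` (l.3–19), verbatim:

## HodgeFermat/CorollaryMRows.lean — generation 29 (seventh addendum, HF-G29h) of the hodge-fermat build

COROLLARY M (`tables/DPRIME-THEOREM.md` §5), the two remaining THEOREM-L clauses, AT THE LEVEL `m` (same hypotheses as
`CorollaryM.lean`: a DISJOINT JOINTLY PRIMITIVE coincidence of CM types `(T, T′)`, `T = (a, b, c)`, `T′ = (a′, b′, c′)`, at a
SQUAREFREE ODD level `m`, zero sums, no entry `≡ 0 (mod m)`; disjointness is not used by these two clauses):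

* `five_clause` — if `5 ∣ m`: the pattern at 5 is one of (U, U), (U, Z1), (Z1, Z1) — i.e. neither triple is Z3 at 5 —,
  or `3 ∣ m` and some 5-divisible entry is `≡ ± m/3 (mod m)` (the (Z3, Z1) case "x₁′ = ± m/3" of the corollary); this is
  THEOREM L's row p = 5, `RowsFinal.five_pattern`, re-indexed by the level;
* `three_clause` — [with THEOREM Z3U as the hypothesis `Z3U` of the light module `TheoremZ3U`, closed by
  `TheoremZ3UFinal.z3u` through KR6] if `3 ∣ m` and `m ≠ 21`: the pattern at 3 is not (Z3, U) (in either order) — "(Z3, U)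
  would give m = 21 ∈ B";
* `corollaryM` — the clauses of `CorollaryM.lean` and the two above in ONE statement (hypotheses `ThmUPlus'`, `Z3U`).

No `sorry`, no new `decide`, no axiom beyond [propext, Classical.choice, Quot.sound].

(2) The docstring of `HodgeFermat/CorollaryMThree.lean` (l.3–23), verbatim:

## COROLLARY M — the opening clause "3 ∣ m" (Theorem S6 = THEOREM KR6) and the corollary in final form

`tables/DPRIME-THEOREM.md` §5, COROLLARY M, opens with "3 ∣ m (S6)": a minimal counterexample to Prop D′ — a
DISJOINT coincidence of CM types `T ∼ T′` at a squarefree odd level `m` — has `3 ∣ m`, because at squarefree levels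
prime to `6` there is no nontrivial coincidence at all (Theorem S6).  In the kernel Theorem S6 IS THEOREM KR6 of
generation 28 (`TheoremKR.kr6`, closed via LEMMA W / THEOREM D6; 3 ∤ N): two triples of a squarefree level `N` prime
to `6` with the same CM type are permutations of each other mod `N` — so they share every entry and cannot be
disjoint.  This module states the clause with THEOREM KR6 as the explicit hypothesis `KR6'` (the verbatim copy in the
light module `TheoremZ3U`, linked by `TheoremZ3UFinal.kr6' : KR6' := TheoremKR.kr6`):

* `three_dvd (hKR : KR6') … (hD : disjoint) (hH : SameType …) : 3 ∣ m` — joint primitivity is not needed;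
* `corollaryM_final (hKR : KR6') (hUplus : ThmUPlus') …` — COROLLARY M in final form: `3 ∣ m`; (U, U) at every prime
  `q ≥ 7`; `gcd(x, m) ∣ 15`; `5 ∤ m` and all entries prime to `3` ⟹ `m ∈ {21, 39}`; the clause at `5`; the clause at `3`
  for `m ≠ 21` (its premise `3 ∣ m` now discharged).  Hypotheses: THEOREM KR6 and THEOREM U⁺ ONLY — each a kernel
  theorem of an earlier generation (`TheoremKRFinal.kr6` gen 28, `thmUPlus` gen 26), carried by name because their cones
  are heavy; THEOREM Z3U, needed by the clause at `3`, is DERIVED here from `KR6'` by the light theorem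
  `TheoremZ3U.z3u_of_kr6` (generation 29), so it is no longer a hypothesis.

LIGHT module (imports `CorollaryMRows`).  No `sorry`, no `decide`, no `native_decide`.  Generation 29, addendum HF-G29i.
-/

/-! ## (1/2) `HodgeFermat/CorollaryMRows.lean` — source lines 21–110 -/

set_option autoImplicit false

namespace HodgeFermat.KRFree.CorollaryMRows

open HodgeFermat.KRFree.LemmaN
open HodgeFermat.KRFree.TheoremUEq (ThmUPlus')
open HodgeFermat.KRFree.TheoremZ3U (Z3U)
open HodgeFermat.KRFree.RowsFinal (five_pattern)
open HodgeFermat.KRFree.Decoding (st_symm)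
open HodgeFermat.KRFree.CorollaryM (prime_UU gcd_dvd_fifteen level_of_units three_or_five_dvd)

/-- **COROLLARY M, clause at 5**: for `5 ∣ m`, neither triple is Z3 at 5 (so the pattern at 5 is (U, U), (U, Z1) or
(Z1, Z1)), unless `3 ∣ m` and a 5-divisible entry is `≡ m/3` or `≡ 2m/3 (mod m)` (the (Z3, Z1) case). -/
theorem five_clause (m a b c a' b' c' : ℕ) (hsq : Squarefree m) (hodd : Odd m)
    (hs : m ∣ a + b + c) (ha : ¬ m ∣ a) (hb : ¬ m ∣ b) (hc : ¬ m ∣ c)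
    (hs' : m ∣ a' + b' + c') (ha' : ¬ m ∣ a') (hb' : ¬ m ∣ b') (hc' : ¬ m ∣ c')
    (hJ : ∀ q, Nat.Prime q → q ∣ m → q ∣ a → q ∣ b → q ∣ c → q ∣ a' → q ∣ b' → q ∣ c' → False)
    (hH : SameType m (a, b, c) (a', b', c'))
    (h5 : 5 ∣ m) :
    (¬ (5 ∣ a ∧ 5 ∣ b ∧ 5 ∣ c) ∧ ¬ (5 ∣ a' ∧ 5 ∣ b' ∧ 5 ∣ c')) ∨
    (3 ∣ m ∧ ∃ v, (v = a ∨ v = b ∨ v = c ∨ v = a' ∨ v = b' ∨ v = c') ∧ 5 ∣ v ∧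
      (v % m = m / 3 ∨ v % m = 2 * (m / 3))) := by
  obtain ⟨n, rfl⟩ := h5
  have h5n : ¬ 5 ∣ n := fun h =>
    (by norm_num : (5:ℕ) ≠ 1) (Nat.isUnit_iff.mp (hsq 5 (Nat.mul_dvd_mul_left 5 h)))
  have hoddn : Odd n := (Nat.odd_mul.mp hodd).2
  have hn : 0 < n := hoddn.pos
  have hJP : ¬ (5 ∣ a ∧ 5 ∣ b ∧ 5 ∣ c ∧ 5 ∣ a' ∧ 5 ∣ b' ∧ 5 ∣ c') := fun h =>
    hJ 5 Nat.prime_five (dvd_mul_right 5 n) h.1 h.2.1 h.2.2.1 h.2.2.2.1 h.2.2.2.2.1 h.2.2.2.2.2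
  rcases five_pattern n a b c a' b' c' h5n hn hoddn hs ha hb hc hs' ha' hb' hc' hJP hH with h | ⟨h3, v, hv⟩
  · exact Or.inl h
  · exact Or.inr ⟨dvd_mul_of_dvd_right h3 5, v, hv⟩

/-- the (Z3, U) exclusion in one order, from the hypothesis `Z3U`. -/
lemma not_Z3U (hZ : Z3U) (m a b c a' b' c' : ℕ) (hsq : Squarefree m) (hodd : Odd m) (hm : m ≠ 21)
    (hs : m ∣ a + b + c) (ha : ¬ m ∣ a) (hb : ¬ m ∣ b) (hc : ¬ m ∣ c)
    (hs' : m ∣ a' + b' + c')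
    (hJ : ∀ q, Nat.Prime q → q ∣ m → q ∣ a → q ∣ b → q ∣ c → q ∣ a' → q ∣ b' → q ∣ c' → False)
    (hH : SameType m (a, b, c) (a', b', c'))
    (h3 : 3 ∣ m) :
    ¬ (3 ∣ a ∧ 3 ∣ b ∧ 3 ∣ c ∧ ¬ 3 ∣ a' ∧ ¬ 3 ∣ b' ∧ ¬ 3 ∣ c') := by
  rintro ⟨⟨a₀, rfl⟩, ⟨b₀, rfl⟩, ⟨c₀, rfl⟩, ha', hb', hc'⟩
  obtain ⟨n, rfl⟩ := h3
  have h2n : ¬ 2 ∣ n := fun h =>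
    (Nat.not_even_iff_odd.mpr hodd) (even_iff_two_dvd.mpr (dvd_mul_of_dvd_right h 3))
  have hJ' : ∀ q, Nat.Prime q → q ∣ 3 * n → q ∣ 3 * a₀ → q ∣ 3 * b₀ → q ∣ 3 * c₀ → q ∣ a' → q ∣ b' → q ∣ c' →
      False := hJ
  exact hm (hZ n a₀ b₀ c₀ a' b' c' hsq h2n hs hs' ha hb hc ha' hb' hc' hJ' hH)

/-- **COROLLARY M, clause at 3** [THEOREM Z3U as hypothesis]: for `3 ∣ m`, `m ≠ 21`, the pattern at 3 is not (Z3, U) —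
neither `T` all divisible by 3 with `T′` prime to 3, nor the other way round. -/
theorem three_clause (hZ : Z3U) (m a b c a' b' c' : ℕ) (hsq : Squarefree m) (hodd : Odd m) (hm : m ≠ 21)
    (hs : m ∣ a + b + c) (ha : ¬ m ∣ a) (hb : ¬ m ∣ b) (hc : ¬ m ∣ c)
    (hs' : m ∣ a' + b' + c') (ha' : ¬ m ∣ a') (hb' : ¬ m ∣ b') (hc' : ¬ m ∣ c')
    (hJ : ∀ q, Nat.Prime q → q ∣ m → q ∣ a → q ∣ b → q ∣ c → q ∣ a' → q ∣ b' → q ∣ c' → False)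
    (hH : SameType m (a, b, c) (a', b', c'))
    (h3 : 3 ∣ m) :
    ¬ (3 ∣ a ∧ 3 ∣ b ∧ 3 ∣ c ∧ ¬ 3 ∣ a' ∧ ¬ 3 ∣ b' ∧ ¬ 3 ∣ c') ∧
    ¬ (3 ∣ a' ∧ 3 ∣ b' ∧ 3 ∣ c' ∧ ¬ 3 ∣ a ∧ ¬ 3 ∣ b ∧ ¬ 3 ∣ c) := by
  refine ⟨not_Z3U hZ m a b c a' b' c' hsq hodd hm hs ha hb hc hs' hJ hH h3, ?_⟩
  have hJ' : ∀ q, Nat.Prime q → q ∣ m → q ∣ a' → q ∣ b' → q ∣ c' → q ∣ a → q ∣ b → q ∣ c → False :=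
    fun q hq hqm h1 h2 h3' h4 h5 h6 => hJ q hq hqm h4 h5 h6 h1 h2 h3'
  exact not_Z3U hZ m a' b' c' a b c hsq hodd hm hs' ha' hb' hc' hs hJ' (st_symm hH) h3

/-- **COROLLARY M in one statement** [THEOREM U⁺ and THEOREM Z3U as hypotheses]: for a disjoint jointly primitive
coincidence of CM types at a squarefree odd level `m`: (U, U) at every prime `q ≥ 7` of `m`; every entry `x` has
`gcd(x, m) ∣ 15`; `3 ∣ m ∨ 5 ∣ m`; if `5 ∤ m` and all entries are prime to 3 then `m ∈ {21, 39}`; if `5 ∣ m` the clause at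
5; if `3 ∣ m` and `m ≠ 21` the clause at 3. -/
theorem corollaryM (hUplus : ThmUPlus') (hZ : Z3U) (m a b c a' b' c' : ℕ) (hsq : Squarefree m) (hodd : Odd m)
    (hs : m ∣ a + b + c) (ha : ¬ m ∣ a) (hb : ¬ m ∣ b) (hc : ¬ m ∣ c)
    (hs' : m ∣ a' + b' + c') (ha' : ¬ m ∣ a') (hb' : ¬ m ∣ b') (hc' : ¬ m ∣ c')
    (hJ : ∀ q, Nat.Prime q → q ∣ m → q ∣ a → q ∣ b → q ∣ c → q ∣ a' → q ∣ b' → q ∣ c' → False)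
    (hD : ∀ u v, (u = a ∨ u = b ∨ u = c) → (v = a' ∨ v = b' ∨ v = c') → ¬ u ≡ v [MOD m])
    (hH : SameType m (a, b, c) (a', b', c')) :
    (∀ q, Nat.Prime q → 7 ≤ q → q ∣ m → ¬ q ∣ a ∧ ¬ q ∣ b ∧ ¬ q ∣ c ∧ ¬ q ∣ a' ∧ ¬ q ∣ b' ∧ ¬ q ∣ c') ∧
    (∀ x, (x = a ∨ x = b ∨ x = c ∨ x = a' ∨ x = b' ∨ x = c') → Nat.gcd x m ∣ 15) ∧
    (3 ∣ m ∨ 5 ∣ m) ∧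
    (¬ 5 ∣ m → (¬ 3 ∣ a ∧ ¬ 3 ∣ b ∧ ¬ 3 ∣ c ∧ ¬ 3 ∣ a' ∧ ¬ 3 ∣ b' ∧ ¬ 3 ∣ c') → m = 21 ∨ m = 39) ∧
    (5 ∣ m → (¬ (5 ∣ a ∧ 5 ∣ b ∧ 5 ∣ c) ∧ ¬ (5 ∣ a' ∧ 5 ∣ b' ∧ 5 ∣ c')) ∨
      (3 ∣ m ∧ ∃ v, (v = a ∨ v = b ∨ v = c ∨ v = a' ∨ v = b' ∨ v = c') ∧ 5 ∣ v ∧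
        (v % m = m / 3 ∨ v % m = 2 * (m / 3)))) ∧
    (3 ∣ m → m ≠ 21 → ¬ (3 ∣ a ∧ 3 ∣ b ∧ 3 ∣ c ∧ ¬ 3 ∣ a' ∧ ¬ 3 ∣ b' ∧ ¬ 3 ∣ c') ∧
      ¬ (3 ∣ a' ∧ 3 ∣ b' ∧ 3 ∣ c' ∧ ¬ 3 ∣ a ∧ ¬ 3 ∣ b ∧ ¬ 3 ∣ c)) :=
  ⟨fun q hq h7 hqm => prime_UU m a b c a' b' c' hsq hodd hs ha hb hc hs' ha' hb' hc' hJ hD hH q hq h7 hqm,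
   fun x hx => gcd_dvd_fifteen m a b c a' b' c' hsq hodd hs ha hb hc hs' ha' hb' hc' hJ hD hH x hx,
   three_or_five_dvd hUplus m a b c a' b' c' hsq hodd hs ha hb hc hs' ha' hb' hc' hJ hD hH,
   fun h5 h3 => level_of_units hUplus m a b c a' b' c' hsq hodd h5 hs ha hb hc hs' ha' hb' hc' hJ hD hH h3,
   fun h5 => five_clause m a b c a' b' c' hsq hodd hs ha hb hc hs' ha' hb' hc' hJ hH h5,
   fun h3 hm => three_clause hZ m a b c a' b' c' hsq hodd hm hs ha hb hc hs' ha' hb' hc' hJ hH h3⟩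

end HodgeFermat.KRFree.CorollaryMRows

/-! ## (2/2) `HodgeFermat/CorollaryMThree.lean` — source lines 25–85 -/

set_option autoImplicit false

namespace HodgeFermat.KRFree.CorollaryMThree

open HodgeFermat.KRFree.LemmaN
open HodgeFermat.KRFree.TheoremUEq (ThmUPlus' Perm3)
open HodgeFermat.KRFree.TheoremZ3U (Z3U KR6' z3u_of_kr6)
open HodgeFermat.KRFree.CorollaryMRows (corollaryM)

/-- **COROLLARY M, opening clause "3 ∣ m"** (Theorem S6 = THEOREM KR6 as the hypothesis `KR6'`): a DISJOINT
coincidence of CM types at a squarefree odd level `m` has `3 ∣ m`. -/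
theorem three_dvd (hKR : KR6') (m a b c a' b' c' : ℕ) (hsq : Squarefree m) (hodd : Odd m)
    (hs : m ∣ a + b + c) (ha : ¬ m ∣ a) (hb : ¬ m ∣ b) (hc : ¬ m ∣ c)
    (hs' : m ∣ a' + b' + c') (ha' : ¬ m ∣ a') (hb' : ¬ m ∣ b') (hc' : ¬ m ∣ c')
    (hD : ∀ u v, (u = a ∨ u = b ∨ u = c) → (v = a' ∨ v = b' ∨ v = c') → ¬ u ≡ v [MOD m])
    (hH : SameType m (a, b, c) (a', b', c')) : 3 ∣ m := by
  by_contra h3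
  have h2 : ¬ 2 ∣ m := fun h => (Nat.not_even_iff_odd.mpr hodd) (even_iff_two_dvd.mpr h)
  have hP : Perm3 (a % m) (b % m) (c % m) (a' % m) (b' % m) (c' % m) :=
    hKR m a b c a' b' c' hsq h2 h3 hs hs' ha hb hc ha' hb' hc' hH
  have haP : a % m = a' % m ∨ a % m = b' % m ∨ a % m = c' % m := by
    rcases hP with h | h | h | h | h | h
    · exact Or.inl h.1
    · exact Or.inl h.1
    · exact Or.inr (Or.inl h.1)
    · exact Or.inr (Or.inl h.1)
    · exact Or.inr (Or.inr h.1)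
    · exact Or.inr (Or.inr h.1)
  rcases haP with h | h | h
  · exact hD a a' (Or.inl rfl) (Or.inl rfl) h
  · exact hD a b' (Or.inl rfl) (Or.inr (Or.inl rfl)) h
  · exact hD a c' (Or.inl rfl) (Or.inr (Or.inr rfl)) h

/-- **COROLLARY M in final form** (hypotheses THEOREM KR6 `KR6'` and THEOREM U⁺ `ThmUPlus'` only; THEOREM Z3U is
derived from `KR6'` by `z3u_of_kr6`): for a
DISJOINT JOINTLY PRIMITIVE coincidence of CM types `(a, b, c) ∼ (a', b', c')` at a squarefree odd level `m` —
`3 ∣ m`; every prime `q ≥ 7` of `m` divides no entry; every entry `x` has `gcd(x, m) ∣ 15`; if `5 ∤ m` and all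
entries are prime to `3` then `m ∈ {21, 39}`; if `5 ∣ m`, neither triple is Z3 at `5` or some `5`-divisible entry is
`≡ ± m/3 (mod m)`; if `m ≠ 21`, the pattern at `3` is not (Z3, U). -/
theorem corollaryM_final (hKR : KR6') (hUplus : ThmUPlus') (m a b c a' b' c' : ℕ)
    (hsq : Squarefree m) (hodd : Odd m)
    (hs : m ∣ a + b + c) (ha : ¬ m ∣ a) (hb : ¬ m ∣ b) (hc : ¬ m ∣ c)
    (hs' : m ∣ a' + b' + c') (ha' : ¬ m ∣ a') (hb' : ¬ m ∣ b') (hc' : ¬ m ∣ c')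
    (hJ : ∀ q, Nat.Prime q → q ∣ m → q ∣ a → q ∣ b → q ∣ c → q ∣ a' → q ∣ b' → q ∣ c' → False)
    (hD : ∀ u v, (u = a ∨ u = b ∨ u = c) → (v = a' ∨ v = b' ∨ v = c') → ¬ u ≡ v [MOD m])
    (hH : SameType m (a, b, c) (a', b', c')) :
    3 ∣ m ∧
    (∀ q, Nat.Prime q → 7 ≤ q → q ∣ m → ¬ q ∣ a ∧ ¬ q ∣ b ∧ ¬ q ∣ c ∧ ¬ q ∣ a' ∧ ¬ q ∣ b' ∧ ¬ q ∣ c') ∧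
    (∀ x, (x = a ∨ x = b ∨ x = c ∨ x = a' ∨ x = b' ∨ x = c') → Nat.gcd x m ∣ 15) ∧
    (¬ 5 ∣ m → (¬ 3 ∣ a ∧ ¬ 3 ∣ b ∧ ¬ 3 ∣ c ∧ ¬ 3 ∣ a' ∧ ¬ 3 ∣ b' ∧ ¬ 3 ∣ c') → m = 21 ∨ m = 39) ∧
    (5 ∣ m → (¬ (5 ∣ a ∧ 5 ∣ b ∧ 5 ∣ c) ∧ ¬ (5 ∣ a' ∧ 5 ∣ b' ∧ 5 ∣ c')) ∨
      (3 ∣ m ∧ ∃ v, (v = a ∨ v = b ∨ v = c ∨ v = a' ∨ v = b' ∨ v = c') ∧ 5 ∣ v ∧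
        (v % m = m / 3 ∨ v % m = 2 * (m / 3)))) ∧
    (m ≠ 21 → ¬ (3 ∣ a ∧ 3 ∣ b ∧ 3 ∣ c ∧ ¬ 3 ∣ a' ∧ ¬ 3 ∣ b' ∧ ¬ 3 ∣ c') ∧
      ¬ (3 ∣ a' ∧ 3 ∣ b' ∧ 3 ∣ c' ∧ ¬ 3 ∣ a ∧ ¬ 3 ∣ b ∧ ¬ 3 ∣ c)) := by
  have h3 : 3 ∣ m := three_dvd hKR m a b c a' b' c' hsq hodd hs ha hb hc hs' ha' hb' hc' hD hH
  obtain ⟨h₁, h₂, -, h₄, h₅, h₆⟩ :=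
    corollaryM hUplus (z3u_of_kr6 hKR) m a b c a' b' c' hsq hodd hs ha hb hc hs' ha' hb' hc' hJ hD hH
  exact ⟨h3, h₁, h₂, h₄, h₅, fun hm => h₆ h3 hm⟩

end HodgeFermat.KRFree.CorollaryMThree
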